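import Mathlib
import Literature.NumberTheory.Transcendental.KZCalculus
import Literature.NumberTheory.Transcendental.KZLogCalculusProofs
import Literature.NumberTheory.Transcendental.KZDominatedFamilyRelations
import Literature.NumberTheory.Transcendental.KZSemialgebraicComplex
import Literature.NumberTheory.Transcendental.SemialgebraicMapsProofs
import Literature.NumberTheory.Transcendental.EllIterRep
import Summits.KontsevichZagierPeriods.KontsevichZagierPeriods.Theses.TorsionLogs

/-!
# Route TorsionLogs — support item `GKZLevelThreePair`: the Clausen reduction, I
# (the move `(ξ,s,τ) ↦ (ξ/√(1-(1-ξ²)s), (1-ξ²)s, τ)` of the open unit cube)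

Helper file for item `stmt-KontsevichZagierPeriods-13812` (`GKZLevelThreePair`).  The prover's
blueprint (v3, attached to the item as evidence) reduces the item to the Clausen–Hobson PRODUCT
FORMULA for the Hesse pencil, read as one KZ equivalence fibred over `ξ`:
`[cube, K(x₀,x₂)K(x₁,x₂)] ∼ (2/√3)·[cube ∋ (ξ,s,τ), K(τ, 1-2(1-ξ²)s)·(s(1-s))^{-1/2}]`.
What turns the right-hand side into `Brep × Trep` (and hence, by the T-chain and the Beta files,
into the item's normal form) is ONE change of variables of the open unit cube (rule (2)),
`Φ(ξ,s,τ) = (ξ/√(1-(1-ξ²)s), (1-ξ²)s, τ)`, a `ℚ`-semialgebraic bijection of `(0,1)³` with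
`|det Φ'| = (1-ξ²)/√(1-(1-ξ²)s)` and `dξ ds/√(s(1-s)) = dv dw/(√(1-v²)√w)`; after it the integrand
is the product `(1-v²)^{-1/2} ⊗ g(w,τ)w^{-1/2}` (value `π/2 · 2T`).  This file proves that move for an
ARBITRARY fibre integrand `g(w,τ)`:

* `hasFDerivAt_sqrtChart`, `det_sqrtChartDeriv` — the derivative of `Φ` and its determinant;
* `sqrtChart_injOn`, `sqrtChart_image` — `Φ` is a bijection of the open cube;
* `cube_sqrtChart_equivalent` — `[cube, g((1-ξ²)s, τ)/√(s(1-s))] ∼ [cube, g(w,τ)/(√(1-v²)√w)]`.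

## References

* M. Kontsevich, D. Zagier, *Periods* (2001), §1.2 rule (2).
* Y. Zhou, *Legendre functions, spherical rotations, and multiple elliptic integrals*,
  Ramanujan J. 34 (2014), Lemma 2.2 (the product formula whose reduction this is).
-/

-- `Summit.<Summit>.<Sub>` with Sub = Summit (single-conjunct summit, D-0017) duplicates the segment.
set_option linter.dupNamespace false

noncomputable section

namespace Summit.KontsevichZagierPeriods.KontsevichZagierPeriods.Theorems.GKZLevelThree

open Set MeasureTheory
open MvPolynomial (aeval X C)
open Literature.NumberTheory.Transcendental Literature.NumberTheory.Transcendental.KZ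
open Literature.ModelTheory.ExponentialFields (IsSemialgebraic isSemialgebraic_setOf_eval_pos)

/-! ## Calculus of the chart -/

/-- The radicand `D(ξ,s) = 1 - (1-ξ²)s` is positive for `ξ² < 1`… in fact for `s < 1` and any `ξ`
with `ξ² ≤ 1`; we only need: `0 < D` on the open cube. -/
theorem sqrtChartD_pos {ξ s : ℝ} (hξ0 : 0 < ξ) (hξ1 : ξ < 1) (hs1 : s < 1) :
    0 < 1 - (1 - ξ ^ 2) * s := by
  have h1 : 0 < 1 - ξ ^ 2 := by nlinarith
  nlinarith [mul_lt_mul_of_pos_left hs1 h1]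

/-- Derivative of the radicand `w ↦ 1 - (1 - w₀²)w₁`. -/
theorem hasFDerivAt_sqrtChartD (z : Fin 3 → ℝ) :
    HasFDerivAt (fun w : Fin 3 → ℝ => 1 - (1 - w 0 ^ 2) * w 1)
      ((2 * z 0 * z 1) • ContinuousLinearMap.proj (R := ℝ) (φ := fun _ : Fin 3 => ℝ) 0 +
        (-(1 - z 0 ^ 2)) • ContinuousLinearMap.proj (R := ℝ) (φ := fun _ : Fin 3 => ℝ) 1) z := by
  have h0 : HasFDerivAt (fun w : Fin 3 → ℝ => w 0)
      (ContinuousLinearMap.proj (R := ℝ) (φ := fun _ : Fin 3 => ℝ) 0) z := hasFDerivAt_apply 0 z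
  have h1 : HasFDerivAt (fun w : Fin 3 → ℝ => w 1)
      (ContinuousLinearMap.proj (R := ℝ) (φ := fun _ : Fin 3 => ℝ) 1) z := hasFDerivAt_apply 1 z
  have h := (hasFDerivAt_const (1:ℝ) z).sub (((hasFDerivAt_const (1:ℝ) z).sub (h0.mul h0)).mul h1)
  refine (h.congr_fderiv ?_).congr_of_eventuallyEq (Filter.Eventually.of_forall fun w => ?_)
  · ext v
    simp
    ring
  · simp [sq]

/-- Derivative of the first coordinate of the chart, `w ↦ w₀/√(1-(1-w₀²)w₁)`, where the radicand
is positive: `∂/∂w₀ = (1-w₁)/(D√D)`, `∂/∂w₁ = w₀(1-w₀²)/(2D√D)`. -/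
theorem hasFDerivAt_sqrtChart₀ (z : Fin 3 → ℝ) (hD : 0 < 1 - (1 - z 0 ^ 2) * z 1) :
    HasFDerivAt (fun w : Fin 3 → ℝ => w 0 / Real.sqrt (1 - (1 - w 0 ^ 2) * w 1))
      (((1 - z 1) / ((1 - (1 - z 0 ^ 2) * z 1) * Real.sqrt (1 - (1 - z 0 ^ 2) * z 1))) •
          ContinuousLinearMap.proj (R := ℝ) (φ := fun _ : Fin 3 => ℝ) 0 +
        (z 0 * (1 - z 0 ^ 2) / (2 * ((1 - (1 - z 0 ^ 2) * z 1) * Real.sqrt (1 - (1 - z 0 ^ 2) * z 1)))) •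
          ContinuousLinearMap.proj (R := ℝ) (φ := fun _ : Fin 3 => ℝ) 1) z := by
  have h0 : HasFDerivAt (fun w : Fin 3 → ℝ => w 0)
      (ContinuousLinearMap.proj (R := ℝ) (φ := fun _ : Fin 3 => ℝ) 0) z := hasFDerivAt_apply 0 z
  have hsqrt := (hasFDerivAt_sqrtChartD z).sqrt hD.ne'
  have hSpos : 0 < Real.sqrt (1 - (1 - z 0 ^ 2) * z 1) := Real.sqrt_pos.2 hD
  have hinv := (hasDerivAt_inv hSpos.ne').comp_hasFDerivAt z hsqrt
  have hmul := h0.mul hinv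
  have hsq : Real.sqrt (1 - (1 - z 0 ^ 2) * z 1) ^ 2 = 1 - (1 - z 0 ^ 2) * z 1 := Real.sq_sqrt hD.le
  refine (hmul.congr_fderiv ?_).congr_of_eventuallyEq (Filter.Eventually.of_forall fun w => ?_)
  · ext v
    simp [hsq]
    field_simp
    ring
  · simp [div_eq_mul_inv]

/-- Derivative of the second coordinate of the chart, `w ↦ (1-w₀²)w₁`. -/
theorem hasFDerivAt_sqrtChart₁ (z : Fin 3 → ℝ) :
    HasFDerivAt (fun w : Fin 3 → ℝ => (1 - w 0 ^ 2) * w 1)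
      ((-(2 * z 0 * z 1)) • ContinuousLinearMap.proj (R := ℝ) (φ := fun _ : Fin 3 => ℝ) 0 +
        (1 - z 0 ^ 2) • ContinuousLinearMap.proj (R := ℝ) (φ := fun _ : Fin 3 => ℝ) 1) z := by
  have h0 : HasFDerivAt (fun w : Fin 3 → ℝ => w 0)
      (ContinuousLinearMap.proj (R := ℝ) (φ := fun _ : Fin 3 => ℝ) 0) z := hasFDerivAt_apply 0 z
  have h1 : HasFDerivAt (fun w : Fin 3 → ℝ => w 1)
      (ContinuousLinearMap.proj (R := ℝ) (φ := fun _ : Fin 3 => ℝ) 1) z := hasFDerivAt_apply 1 z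
  have h := ((hasFDerivAt_const (1:ℝ) z).sub (h0.mul h0)).mul h1
  refine (h.congr_fderiv ?_).congr_of_eventuallyEq (Filter.Eventually.of_forall fun w => ?_)
  · ext v
    simp
    ring
  · simp [sq]

/-- **The chart is differentiable** with derivative `(LinearMap.toContinuousLinearMap (Matrix.toLin' (!![(1 - z 1) / ((1 - (1 - z 0 ^ 2) * z 1) * Real.sqrt (1 - (1 - z 0 ^ 2) * z 1)),
        z 0 * (1 - z 0 ^ 2) / (2 * ((1 - (1 - z 0 ^ 2) * z 1) * Real.sqrt (1 - (1 - z 0 ^ 2) * z 1))), 0;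
      -(2 * z 0 * z 1), 1 - z 0 ^ 2, 0;
      0, 0, 1] : Matrix (Fin 3) (Fin 3) ℝ)) : (Fin 3 → ℝ) →L[ℝ] (Fin 3 → ℝ))` wherever the radicand is
positive. -/
theorem hasFDerivAt_sqrtChart (z : Fin 3 → ℝ) (hD : 0 < 1 - (1 - z 0 ^ 2) * z 1) :
    HasFDerivAt (fun z : Fin 3 → ℝ => (![z 0 / Real.sqrt (1 - (1 - z 0 ^ 2) * z 1), (1 - z 0 ^ 2) * z 1, z 2] : Fin 3 → ℝ)) ((LinearMap.toContinuousLinearMap (Matrix.toLin' (!![(1 - z 1) / ((1 - (1 - z 0 ^ 2) * z 1) * Real.sqrt (1 - (1 - z 0 ^ 2) * z 1)),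
        z 0 * (1 - z 0 ^ 2) / (2 * ((1 - (1 - z 0 ^ 2) * z 1) * Real.sqrt (1 - (1 - z 0 ^ 2) * z 1))), 0;
      -(2 * z 0 * z 1), 1 - z 0 ^ 2, 0;
      0, 0, 1] : Matrix (Fin 3) (Fin 3) ℝ)) : (Fin 3 → ℝ) →L[ℝ] (Fin 3 → ℝ))) z := by
  refine hasFDerivAt_pi'.mpr fun i => ?_
  fin_cases i
  · refine ((hasFDerivAt_sqrtChart₀ z hD).congr_fderiv ?_).congr_of_eventuallyEq
      (Filter.Eventually.of_forall fun w => by simp)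
    ext v
    simp [Matrix.toLin'_apply, dotProduct, Fin.sum_univ_three]
  · refine ((hasFDerivAt_sqrtChart₁ z).congr_fderiv ?_).congr_of_eventuallyEq
      (Filter.Eventually.of_forall fun w => by simp)
    ext v
    simp [Matrix.toLin'_apply, dotProduct, Fin.sum_univ_three]
  · have h2 : HasFDerivAt (fun w : Fin 3 → ℝ => w 2)
        (ContinuousLinearMap.proj (R := ℝ) (φ := fun _ : Fin 3 => ℝ) 2) z := hasFDerivAt_apply 2 z
    refine (h2.congr_fderiv ?_).congr_of_eventuallyEq (Filter.Eventually.of_forall fun w => by simp)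
    ext v
    simp [Matrix.toLin'_apply, dotProduct, Fin.sum_univ_three]

/-- **The Jacobian**: `det Φ'(ξ,s,τ) = (1-ξ²)/√(1-(1-ξ²)s)`. -/
theorem det_sqrtChartDeriv (z : Fin 3 → ℝ) (hD : 0 < 1 - (1 - z 0 ^ 2) * z 1) :
    ((LinearMap.toContinuousLinearMap (Matrix.toLin' (!![(1 - z 1) / ((1 - (1 - z 0 ^ 2) * z 1) * Real.sqrt (1 - (1 - z 0 ^ 2) * z 1)),
        z 0 * (1 - z 0 ^ 2) / (2 * ((1 - (1 - z 0 ^ 2) * z 1) * Real.sqrt (1 - (1 - z 0 ^ 2) * z 1))), 0;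
      -(2 * z 0 * z 1), 1 - z 0 ^ 2, 0;
      0, 0, 1] : Matrix (Fin 3) (Fin 3) ℝ)) : (Fin 3 → ℝ) →L[ℝ] (Fin 3 → ℝ))).det = (1 - z 0 ^ 2) / Real.sqrt (1 - (1 - z 0 ^ 2) * z 1) := by
  have hS : Real.sqrt (1 - (1 - z 0 ^ 2) * z 1) ≠ 0 := (Real.sqrt_pos.2 hD).ne'
  show LinearMap.det (Matrix.toLin' ((!![(1 - z 1) / ((1 - (1 - z 0 ^ 2) * z 1) * Real.sqrt (1 - (1 - z 0 ^ 2) * z 1)),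
        z 0 * (1 - z 0 ^ 2) / (2 * ((1 - (1 - z 0 ^ 2) * z 1) * Real.sqrt (1 - (1 - z 0 ^ 2) * z 1))), 0;
      -(2 * z 0 * z 1), 1 - z 0 ^ 2, 0;
      0, 0, 1] : Matrix (Fin 3) (Fin 3) ℝ))) = _
  rw [LinearMap.det_toLin', Matrix.det_fin_three]
  simp only [Matrix.of_apply, Matrix.cons_val', Matrix.cons_val_zero, Matrix.cons_val_one,
    Matrix.cons_val_two, Matrix.empty_val', Matrix.cons_val_fin_one, Matrix.head_cons,
    Matrix.tail_cons, Matrix.head_fin_const]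
  generalize hSg : Real.sqrt (1 - (1 - z 0 ^ 2) * z 1) = S at hS ⊢
  generalize hDg : 1 - (1 - z 0 ^ 2) * z 1 = D at hD ⊢
  have hD' : D ≠ 0 := hD.ne'
  field_simp
  subst hDg
  ring

/-! ## The chart is a bijection of the open cube -/

/-- `1 - v² = (1-s)(1-ξ²)/D` at `v = ξ/√D`, `D = 1-(1-ξ²)s > 0`. -/
theorem one_sub_sqrtChart_sq {ξ s : ℝ} (hD : 0 < 1 - (1 - ξ ^ 2) * s) :
    1 - (ξ / Real.sqrt (1 - (1 - ξ ^ 2) * s)) ^ 2 = (1 - s) * (1 - ξ ^ 2) / (1 - (1 - ξ ^ 2) * s) := by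
  rw [div_pow, Real.sq_sqrt hD.le]
  field_simp
  ring

/-- `Φ` is injective on the open cube. -/
theorem sqrtChart_injOn : InjOn (fun z : Fin 3 → ℝ => (![z 0 / Real.sqrt (1 - (1 - z 0 ^ 2) * z 1), (1 - z 0 ^ 2) * z 1, z 2] : Fin 3 → ℝ)) {z : Fin 3 → ℝ | (0 < z 0 ∧ z 0 < 1) ∧ (0 < z 1 ∧ z 1 < 1) ∧ (0 < z 2 ∧ z 2 < 1)} := by
  intro z hz z' hz' h
  obtain ⟨⟨hξ0, hξ1⟩, ⟨hs0, hs1⟩, -⟩ := hz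
  obtain ⟨⟨hξ0', hξ1'⟩, ⟨hs0', hs1'⟩, -⟩ := hz'
  have h0 := congr_fun h 0
  have h1 := congr_fun h 1
  have h2 := congr_fun h 2
  simp only [Matrix.cons_val_zero, Matrix.cons_val_one, Matrix.cons_val_two, Matrix.head_cons,
    Matrix.tail_cons] at h0 h1 h2
  -- same `w`, hence same radicand `D = 1 - w`, hence same `ξ`, hence same `s`
  have hD : 1 - (1 - z 0 ^ 2) * z 1 = 1 - (1 - z' 0 ^ 2) * z' 1 := by rw [h1]
  have hDpos : 0 < 1 - (1 - z 0 ^ 2) * z 1 := sqrtChartD_pos hξ0 hξ1 hs1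
  rw [hD] at h0
  have hξ : z 0 = z' 0 := by
    have hS : Real.sqrt (1 - (1 - z' 0 ^ 2) * z' 1) ≠ 0 :=
      (Real.sqrt_pos.2 (sqrtChartD_pos hξ0' hξ1' hs1')).ne'
    field_simp at h0
    exact h0
  have hs : z 1 = z' 1 := by
    rw [hξ] at h1
    have hA : (1 - z' 0 ^ 2) ≠ 0 := by nlinarith
    exact mul_left_cancel₀ hA h1
  ext i
  fin_cases i
  · exact hξ
  · exact hs
  · exact h2

/-- `Φ` maps the open cube onto itself (inverse: `ξ = v√(1-w)`, `s = w/(1-v²(1-w))`). -/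
theorem sqrtChart_image : (fun z : Fin 3 → ℝ => (![z 0 / Real.sqrt (1 - (1 - z 0 ^ 2) * z 1), (1 - z 0 ^ 2) * z 1, z 2] : Fin 3 → ℝ)) '' {z : Fin 3 → ℝ | (0 < z 0 ∧ z 0 < 1) ∧ (0 < z 1 ∧ z 1 < 1) ∧ (0 < z 2 ∧ z 2 < 1)} = {z : Fin 3 → ℝ | (0 < z 0 ∧ z 0 < 1) ∧ (0 < z 1 ∧ z 1 < 1) ∧ (0 < z 2 ∧ z 2 < 1)} := by
  ext y
  simp only [mem_image, mem_setOf_eq]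
  constructor
  · rintro ⟨z, ⟨⟨hξ0, hξ1⟩, ⟨hs0, hs1⟩, hτ0, hτ1⟩, rfl⟩
    have hA : 0 < 1 - z 0 ^ 2 := by nlinarith
    have hD : 0 < 1 - (1 - z 0 ^ 2) * z 1 := sqrtChartD_pos hξ0 hξ1 hs1
    have hS : 0 < Real.sqrt (1 - (1 - z 0 ^ 2) * z 1) := Real.sqrt_pos.2 hD
    refine ⟨⟨by simp only [Matrix.cons_val_zero]; positivity, ?_⟩,
      ⟨by simp only [Matrix.cons_val_one]; exact mul_pos hA hs0, ?_⟩,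
      by simpa using hτ0, by simpa using hτ1⟩
    · -- `ξ/√D < 1 ⟺ ξ² < D`
      simp only [Matrix.cons_val_zero]
      rw [div_lt_one hS, Real.lt_sqrt hξ0.le]
      nlinarith [mul_pos hA (sub_pos.2 hs1)]
    · simp only [Matrix.cons_val_one]
      calc (1 - z 0 ^ 2) * z 1 < (1 - z 0 ^ 2) * 1 := mul_lt_mul_of_pos_left hs1 hA
        _ ≤ 1 := by nlinarith
  · rintro ⟨⟨hv0, hv1⟩, ⟨hw0, hw1⟩, hτ0, hτ1⟩
    have hW : 0 < 1 - y 1 := sub_pos.2 hw1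
    have hV : 0 < 1 - y 0 ^ 2 := by nlinarith
    have hE : 0 < 1 - y 0 ^ 2 * (1 - y 1) := by nlinarith [mul_pos hV hW]
    set ξ : ℝ := y 0 * Real.sqrt (1 - y 1) with hξ
    set s : ℝ := y 1 / (1 - y 0 ^ 2 * (1 - y 1)) with hs
    have hsqW : Real.sqrt (1 - y 1) ^ 2 = 1 - y 1 := Real.sq_sqrt hW.le
    have hSW : 0 < Real.sqrt (1 - y 1) := Real.sqrt_pos.2 hW
    have hξ2 : ξ ^ 2 = y 0 ^ 2 * (1 - y 1) := by rw [hξ, mul_pow, hsqW]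
    have hξ0 : 0 < ξ := mul_pos hv0 hSW
    have hξ1 : ξ < 1 := by
      calc ξ = y 0 * Real.sqrt (1 - y 1) := rfl
        _ < 1 * 1 := mul_lt_mul'' hv1 ((Real.sqrt_lt' one_pos).2 (by linarith)) hv0.le hSW.le
        _ = 1 := one_mul 1
    have hs0 : 0 < s := div_pos hw0 hE
    have hs1 : s < 1 := by rw [hs, div_lt_one hE]; nlinarith [mul_pos hV hw0]
    -- the key identities
    have hw : (1 - ξ ^ 2) * s = y 1 := by rw [hξ2, hs]; field_simp
    have hD : 1 - (1 - ξ ^ 2) * s = 1 - y 1 := by rw [hw]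
    refine ⟨![ξ, s, y 2], ⟨⟨hξ0, hξ1⟩, ⟨by simpa using hs0, by simpa using hs1⟩, by simpa using hτ0,
      by simpa using hτ1⟩, ?_⟩
    ext i
    fin_cases i
    · show (fun z : Fin 3 → ℝ => (![z 0 / Real.sqrt (1 - (1 - z 0 ^ 2) * z 1), (1 - z 0 ^ 2) * z 1, z 2] : Fin 3 → ℝ)) ![ξ, s, y 2] 0 = y 0
      simp only [Matrix.cons_val_zero, Matrix.cons_val_one]
      rw [hD, hξ, mul_div_assoc, div_self hSW.ne', mul_one]
    · show (fun z : Fin 3 → ℝ => (![z 0 / Real.sqrt (1 - (1 - z 0 ^ 2) * z 1), (1 - z 0 ^ 2) * z 1, z 2] : Fin 3 → ℝ)) ![ξ, s, y 2] 1 = y 1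
      simp only [Matrix.cons_val_zero, Matrix.cons_val_one]
      exact hw
    · show (fun z : Fin 3 → ℝ => (![z 0 / Real.sqrt (1 - (1 - z 0 ^ 2) * z 1), (1 - z 0 ^ 2) * z 1, z 2] : Fin 3 → ℝ)) ![ξ, s, y 2] 2 = y 2
      simp

/-! ## The move -/

/-- `Φ` is `ℚ`-semialgebraic on any `ℚ`-semialgebraic subset of the open cube. -/
theorem isSemialgebraicMapOn_sqrtChart {S : Set (Fin 3 → ℝ)} (hS : IsSemialgebraic ℚ S)
    (hSsub : S ⊆ {z : Fin 3 → ℝ | (0 < z 0 ∧ z 0 < 1) ∧ (0 < z 1 ∧ z 1 < 1) ∧ (0 < z 2 ∧ z 2 < 1)}) : IsSemialgebraicMapOn ℚ S (fun z : Fin 3 → ℝ => (![z 0 / Real.sqrt (1 - (1 - z 0 ^ 2) * z 1), (1 - z 0 ^ 2) * z 1, z 2] : Fin 3 → ℝ)) := by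
  have hX0 : IsSemialgebraicFunOn ℚ S (fun z => z 0) :=
    (isSemialgebraicFunOn_aeval hS (X 0 : MvPolynomial (Fin 3) ℚ)).congr fun z _ => by simp
  have hX2 : IsSemialgebraicFunOn ℚ S (fun z => z 2) :=
    (isSemialgebraicFunOn_aeval hS (X 2 : MvPolynomial (Fin 3) ℚ)).congr fun z _ => by simp
  have hW : IsSemialgebraicFunOn ℚ S (fun z => (1 - z 0 ^ 2) * z 1) :=
    (isSemialgebraicFunOn_aeval hS ((1 - X 0 ^ 2) * X 1 : MvPolynomial (Fin 3) ℚ)).congr fun z _ => by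
      simp
  have hD : IsSemialgebraicFunOn ℚ S (fun z => 1 - (1 - z 0 ^ 2) * z 1) :=
    (isSemialgebraicFunOn_aeval hS (1 - (1 - X 0 ^ 2) * X 1 : MvPolynomial (Fin 3) ℚ)).congr
      fun z _ => by simp
  have hsqrt : IsSemialgebraicFunOn ℚ S (fun z => Real.sqrt (1 - (1 - z 0 ^ 2) * z 1)) :=
    IsSemialgebraicFunOn.sqrt_holds hD
  have hne : ∀ z ∈ S, Real.sqrt (1 - (1 - z 0 ^ 2) * z 1) ≠ 0 := fun z hz => by
    obtain ⟨⟨hξ0, hξ1⟩, ⟨_, hs1⟩, -⟩ := hSsub hz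
    exact (Real.sqrt_pos.2 (sqrtChartD_pos hξ0 hξ1 hs1)).ne'
  refine IsSemialgebraicMapOn.of_forall hS fun j => ?_
  fin_cases j
  · exact (hX0.div hsqrt hne).congr fun z _ => by simp
  · exact hW.congr fun z _ => by simp
  · exact hX2.congr fun z _ => by simp

/-- **The weight identity** of the move: `dξ ds/√(s(1-s)) = dv dw/(√(1-v²)√w)`, i.e.
`c/√(s(1-s)) = (√(1-v²))⁻¹ · (c/√w) · |det Φ'|` at `v = ξ/√D`, `w = (1-ξ²)s`. -/
theorem sqrtChart_weight (c : ℝ) {ξ s : ℝ} (hξ0 : 0 < ξ) (hξ1 : ξ < 1) (hs0 : 0 < s) (hs1 : s < 1) :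
    c / Real.sqrt (s * (1 - s)) =
      (Real.sqrt (1 - (ξ / Real.sqrt (1 - (1 - ξ ^ 2) * s)) ^ 2))⁻¹ *
        (c / Real.sqrt ((1 - ξ ^ 2) * s)) * ((1 - ξ ^ 2) / Real.sqrt (1 - (1 - ξ ^ 2) * s)) := by
  have hA : 0 < 1 - ξ ^ 2 := by nlinarith
  have hT : 0 < 1 - s := sub_pos.2 hs1
  have hD : 0 < 1 - (1 - ξ ^ 2) * s := sqrtChartD_pos hξ0 hξ1 hs1
  have h1 : Real.sqrt ((1 - s) * (1 - ξ ^ 2) / (1 - (1 - ξ ^ 2) * s)) =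
      Real.sqrt (1 - s) * Real.sqrt (1 - ξ ^ 2) / Real.sqrt (1 - (1 - ξ ^ 2) * s) := by
    rw [Real.sqrt_div (mul_nonneg hT.le hA.le), Real.sqrt_mul hT.le]
  have h2 : Real.sqrt (s * (1 - s)) = Real.sqrt s * Real.sqrt (1 - s) := Real.sqrt_mul hs0.le _
  have h3 : Real.sqrt ((1 - ξ ^ 2) * s) = Real.sqrt (1 - ξ ^ 2) * Real.sqrt s := Real.sqrt_mul hA.le _
  rw [one_sub_sqrtChart_sq hD, h1, h2, h3]
  have ha := Real.sq_sqrt hT.le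
  have hb := Real.sq_sqrt hA.le
  have hd := Real.sq_sqrt hD.le
  have he := Real.sq_sqrt hs0.le
  have ha0 := Real.sqrt_pos.2 hT
  have hb0 := Real.sqrt_pos.2 hA
  have hd0 := Real.sqrt_pos.2 hD
  have he0 := Real.sqrt_pos.2 hs0
  generalize Real.sqrt (1 - s) = a at *
  generalize Real.sqrt (1 - ξ ^ 2) = b at *
  generalize Real.sqrt (1 - (1 - ξ ^ 2) * s) = d at *
  generalize Real.sqrt s = e at *
  rw [← hb]
  have ha' : a ≠ 0 := ha0.ne'
  have hb' : b ≠ 0 := hb0.ne'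
  have hd' : d ≠ 0 := hd0.ne'
  have he' : e ≠ 0 := he0.ne'
  field_simp

/-- **The Clausen-reduction move** (rule (2) in dimension 3).  For ANY fibre integrand `g(w,τ)`:
if `P = [(0,1)³ ∋ (ξ,s,τ), g((1-ξ²)s, τ)/√(s(1-s))]` and `Q = [(0,1)³ ∋ (v,w,τ), (1-v²)^{-1/2} · g(w,τ)/√w]`
(pinned), then `P ∼ Q`, by the change of variables `Φ(ξ,s,τ) = (ξ/√(1-(1-ξ²)s), (1-ξ²)s, τ)`:
a `ℚ`-semialgebraic bijection of the open cube with `|det Φ'| = (1-ξ²)/√(1-(1-ξ²)s)` and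
`g((1-ξ²)s,τ)/√(s(1-s)) = Q.integrand(Φ(ξ,s,τ)) · |det Φ'|`.  With
`g(w,τ) = (2/√3)·τ^{-1/3}(1-τ)^{-2/3}(1-wτ)^{-1/3}` this carries the right-hand side of the
Clausen–Hobson product formula for the Hesse pencil (fibred over `ξ`) to the product
`(2/√3)·[(0,1),(1-v²)^{-1/2}] × [(0,1)², K(τ,1-2w)w^{-1/2}]` (value `(2/√3)·(π/2)·2T = B·T`).
[Kontsevich–Zagier 2001, §1.2 rule (2)] -/
theorem cube_sqrtChart_equivalent (g : ℝ → ℝ → ℝ) (P Q : IntegralRep 3)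
    (hPd : P.domain = {z : Fin 3 → ℝ | (0 < z 0 ∧ z 0 < 1) ∧ (0 < z 1 ∧ z 1 < 1) ∧ (0 < z 2 ∧ z 2 < 1)})
    (hPi : EqOn P.integrand (fun z => g ((1 - z 0 ^ 2) * z 1) (z 2) / Real.sqrt (z 1 * (1 - z 1)))
      P.domain)
    (hQd : Q.domain = {z : Fin 3 → ℝ | (0 < z 0 ∧ z 0 < 1) ∧ (0 < z 1 ∧ z 1 < 1) ∧ (0 < z 2 ∧ z 2 < 1)})
    (hQi : EqOn Q.integrand
      (fun z => (Real.sqrt (1 - z 0 ^ 2))⁻¹ * (g (z 1) (z 2) / Real.sqrt (z 1))) Q.domain) :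
    Equivalent P Q := by
  have hdom : ∀ z ∈ P.domain, (0 < z 0 ∧ z 0 < 1) ∧ (0 < z 1 ∧ z 1 < 1) ∧ (0 < z 2 ∧ z 2 < 1) :=
    fun z hz => by rwa [hPd] at hz
  have hsa : IsSemialgebraicMapOn ℚ P.domain (fun z : Fin 3 → ℝ => (![z 0 / Real.sqrt (1 - (1 - z 0 ^ 2) * z 1), (1 - z 0 ^ 2) * z 1, z 2] : Fin 3 → ℝ)) :=
    isSemialgebraicMapOn_sqrtChart P.isSemialgebraic_domain (by rw [hPd])
  have hder : ∀ z ∈ P.domain, HasFDerivWithinAt (fun z : Fin 3 → ℝ => (![z 0 / Real.sqrt (1 - (1 - z 0 ^ 2) * z 1), (1 - z 0 ^ 2) * z 1, z 2] : Fin 3 → ℝ)) ((LinearMap.toContinuousLinearMap (Matrix.toLin' (!![(1 - z 1) / ((1 - (1 - z 0 ^ 2) * z 1) * Real.sqrt (1 - (1 - z 0 ^ 2) * z 1)),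
        z 0 * (1 - z 0 ^ 2) / (2 * ((1 - (1 - z 0 ^ 2) * z 1) * Real.sqrt (1 - (1 - z 0 ^ 2) * z 1))), 0;
      -(2 * z 0 * z 1), 1 - z 0 ^ 2, 0;
      0, 0, 1] : Matrix (Fin 3) (Fin 3) ℝ)) : (Fin 3 → ℝ) →L[ℝ] (Fin 3 → ℝ))) P.domain z :=
    fun z hz => by
      obtain ⟨⟨hξ0, hξ1⟩, ⟨_, hs1⟩, -⟩ := hdom z hz
      exact (hasFDerivAt_sqrtChart z (sqrtChartD_pos hξ0 hξ1 hs1)).hasFDerivWithinAt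
  have hinj : InjOn (fun z : Fin 3 → ℝ => (![z 0 / Real.sqrt (1 - (1 - z 0 ^ 2) * z 1), (1 - z 0 ^ 2) * z 1, z 2] : Fin 3 → ℝ)) P.domain := by rw [hPd]; exact sqrtChart_injOn
  have himage : Q.domain = (fun z : Fin 3 → ℝ => (![z 0 / Real.sqrt (1 - (1 - z 0 ^ 2) * z 1), (1 - z 0 ^ 2) * z 1, z 2] : Fin 3 → ℝ)) '' P.domain := by rw [hQd, hPd, sqrtChart_image]
  have hint : ∀ z ∈ P.domain, P.integrand z = Q.integrand ((fun z : Fin 3 → ℝ => (![z 0 / Real.sqrt (1 - (1 - z 0 ^ 2) * z 1), (1 - z 0 ^ 2) * z 1, z 2] : Fin 3 → ℝ)) z) * |((LinearMap.toContinuousLinearMap (Matrix.toLin' (!![(1 - z 1) / ((1 - (1 - z 0 ^ 2) * z 1) * Real.sqrt (1 - (1 - z 0 ^ 2) * z 1)),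
        z 0 * (1 - z 0 ^ 2) / (2 * ((1 - (1 - z 0 ^ 2) * z 1) * Real.sqrt (1 - (1 - z 0 ^ 2) * z 1))), 0;
      -(2 * z 0 * z 1), 1 - z 0 ^ 2, 0;
      0, 0, 1] : Matrix (Fin 3) (Fin 3) ℝ)) : (Fin 3 → ℝ) →L[ℝ] (Fin 3 → ℝ))).det| := by
    intro z hz
    obtain ⟨⟨hξ0, hξ1⟩, ⟨hs0, hs1⟩, -⟩ := hdom z hz
    have hA : 0 < 1 - z 0 ^ 2 := by nlinarith
    have hD : 0 < 1 - (1 - z 0 ^ 2) * z 1 := sqrtChartD_pos hξ0 hξ1 hs1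
    have hΦz : (fun z : Fin 3 → ℝ => (![z 0 / Real.sqrt (1 - (1 - z 0 ^ 2) * z 1), (1 - z 0 ^ 2) * z 1, z 2] : Fin 3 → ℝ)) z ∈ Q.domain := by rw [himage]; exact mem_image_of_mem _ hz
    rw [hPi hz, hQi hΦz, det_sqrtChartDeriv z hD, abs_of_pos (div_pos hA (Real.sqrt_pos.2 hD))]
    simp only [Matrix.cons_val_zero, Matrix.cons_val_one, Matrix.cons_val_two, Matrix.head_cons,
      Matrix.tail_cons]
    exact sqrtChart_weight _ hξ0 hξ1 hs0 hs1
  exact changeOfVariablesRel_subset_relations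
    ⟨3, P, Q, (fun z : Fin 3 → ℝ => (![z 0 / Real.sqrt (1 - (1 - z 0 ^ 2) * z 1), (1 - z 0 ^ 2) * z 1, z 2] : Fin 3 → ℝ)), fun z => (LinearMap.toContinuousLinearMap (Matrix.toLin' (!![(1 - z 1) / ((1 - (1 - z 0 ^ 2) * z 1) * Real.sqrt (1 - (1 - z 0 ^ 2) * z 1)),
        z 0 * (1 - z 0 ^ 2) / (2 * ((1 - (1 - z 0 ^ 2) * z 1) * Real.sqrt (1 - (1 - z 0 ^ 2) * z 1))), 0;
      -(2 * z 0 * z 1), 1 - z 0 ^ 2, 0;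
      0, 0, 1] : Matrix (Fin 3) (Fin 3) ℝ)) : (Fin 3 → ℝ) →L[ℝ] (Fin 3 → ℝ)), hsa, hder, hinj, himage, hint, rfl⟩

end Summit.KontsevichZagierPeriods.KontsevichZagierPeriods.Theorems.GKZLevelThree

end
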